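import Literature.AlgebraicTopology.SingularHomology.LerayHirschTransport
import Literature.AlgebraicTopology.SingularHomology.CohomologyDisjointOpenCover
import Mathlib.Topology.PartitionOfUnity
import HarnessLib

/-!
# The Leray–Hirsch theorem over covers: disjoint unions, finite unions, and the passage to the whole base

Topic `Literature/AlgebraicTopology/SingularHomology`. D. Husemoller, *Fibre Bundles*, 3rd ed.
(1994), Ch. 17 §1, proof of the Leray–Hirsch theorem 1.1: "if `θ_U`, `θ_V`, `θ_{U ∩ V}` are
isomorphisms then `θ_{U ∪ V}` is an isomorphism … by induction the theorem holds over every finite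
union of trivialising open sets" — in the book for bundles of FINITE TYPE (Remark 1.2: the general
case by a spectral sequence). A. Hatcher, *Algebraic Topology* (2002), proof of Thm. 4D.1 p. 433
and §3.1 p. 202 (additivity over disjoint unions); J. Milnor, J. Stasheff, *Characteristic
Classes* (1974), §5 proof of Lemma 5.9 (over a paracompact base one reduces to countably many
trivialising open sets which are disjoint unions, and then to two by a telescope / band trick).

In the tree's setting (`LHSubset.lhMap`, `IsLHOn`, `isLHOn_union`, `H*_X(W)`) we PROVE the
cover-combinatorial part of the theorem for an ARBITRARY base:

* `subsetCochains.resH_pi_bijective` — **`H*_X(⊔ W_a) ≅ ∏_a H*_X(W_a)`** for pairwise disjoint open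
  `W_a` (from the tree's additivity `CohomologyDisjointOpenCover.piRestrict_bijective`);
* `LHSubset.isLHOn_iUnion_of_disjoint` — Leray–Hirsch over each of pairwise disjoint open `U_a`
  gives it over `⋃ U_a`;
* `LHSubset.LocLH U` — "Leray–Hirsch holds over every open `U' ⊆ U`" (the hereditary form), closed
  under open subsets, binary unions (`locLH_union`, the gluing step), finite unions
  (`locLH_biUnion_finset`) and pairwise disjoint unions (`locLH_iUnion_of_disjoint`);
* **`LHSubset.locLH_univ_of_nat_cover`** — over a paracompact normal base, if `LocLH` holds over
  every finite union `V 0 ∪ … ∪ V k` of a countable open cover `V`, it holds over the whole base: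
  with a partition of unity `ψ` subordinate to `V` and the "height" `h = Σ k ψ_k`, the bands
  `A_k = h⁻¹(k - 1, k + 1)` lie in `V 0 ∪ … ∪ V k`, the odd bands are pairwise disjoint and so are
  the even ones, and the base is the union of the two disjoint unions.

Everything is proved; no named facts.

## References

* [HusemollerFibreBundles1994] D. Husemoller, *Fibre Bundles*, 3rd ed. (1994), Ch. 17 §1 Thm. 1.1, Rem. 1.2.
* [HatcherAT2002] A. Hatcher, *Algebraic Topology*, CUP 2002, Thm. 4D.1 p. 433, §3.1 p. 202.
* [MilnorStasheffAMS76] J. Milnor, J. Stasheff, *Characteristic Classes* (1974), §5 Lemma 5.9 (proof).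
-/

noncomputable section

-- as in `LerayHirschTransport`: chains of the concrete complex are `Finsupp`s up to unfolding of
-- semireducible definitions
set_option backward.isDefEq.respectTransparency false

open CategoryTheory Limits Set Function

universe u v

namespace Literature.AlgebraicTopology.SingularHomology

/-! ### `H*_X(⊔ W_a) ≅ ∏ H*_X(W_a)` -/

namespace subsetCochains

variable {R : Type v} [CommRing R] {X : Type u} [TopologicalSpace X]

/-- Local notation: the coefficient object `ULift R` of `ModuleCat.{max u v} R`. -/
local notation "𝑹" => SimplexSpan.coefR R

/-- `{x : ↥W // x.1 ∈ W'} ≃ₜ ↥W'` for `W' ⊆ W`. [folklore] -/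
def preimageValHomeomorph {W W' : Set X} (h : W' ⊆ W) : ↥((Subtype.val : ↥W → X) ⁻¹' W') ≃ₜ ↥W' where
  toFun x := ⟨x.1.1, x.2⟩
  invFun y := ⟨⟨y.1, h y.2⟩, y.2⟩
  left_inv _ := rfl
  right_inv _ := rfl
  continuous_toFun := (continuous_subtype_val.comp continuous_subtype_val).subtype_mk _
  continuous_invFun := (continuous_subtype_val.subtype_mk _).subtype_mk _

/-- **Additivity of `H*_X` over pairwise disjoint open subsets**: the restrictions
`H^p_X(⋃ W_a) → ∏_a H^p_X(W_a)` form a bijection (Hatcher 2002, §3.1 p. 202: a singular simplex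
lies in exactly one of the pieces). [cite: HatcherAT2002, §3.1 p. 202] -/
theorem resH_pi_bijective {α : Type} (W : α → Set X) (hWo : ∀ a, IsOpen (W a)) (hdis : Pairwise (Disjoint on W)) (p : ℕ) :
    Function.Bijective (fun z : (subsetCochains R 𝑹 (⋃ a, W a)).homology p ↦
      fun a ↦ resH (N := 𝑹) (subset_iUnion W a) p z) := by
  -- the clopen partition of `↥(⋃ W_a)` by the pieces
  let P : α → Set ↥(⋃ a, W a) := fun a ↦ (Subtype.val : ↥(⋃ a, W a) → X) ⁻¹' W a
  have hP : IsClopenPartition P :=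
    { isOpen := fun a ↦ (hWo a).preimage continuous_subtype_val
      disjoint := fun a b hab ↦ (hdis hab).preimage _
      exists_mem := fun x ↦ by
        obtain ⟨a, ha⟩ := mem_iUnion.1 x.2
        exact ⟨a, ha⟩ }
  have hpi := singularCohomology.piRestrict_bijective (R := R) (M := R) hP p
  -- the identification of the pieces with the `↥(W a)`
  let θ : ∀ a, ↥(P a) ≃ₜ ↥(W a) := fun a ↦ preimageValHomeomorph (subset_iUnion W a)
  let Φ : (∀ a, (subsetCochains R 𝑹 (W a)).homology p) → ∀ a, singularCohomology R R ↥(P a) p := fun y a ↦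
    singularCohomology.map R R (θ a : C(↥(P a), ↥(W a))) p ((homologyIsoSingularCohomology R (W a) p).hom (y a))
  have hΦ : Function.Bijective Φ := by
    have hcomp : ∀ a, Function.Bijective (fun y : (subsetCochains R 𝑹 (W a)).homology p ↦
        singularCohomology.map R R (θ a : C(↥(P a), ↥(W a))) p ((homologyIsoSingularCohomology R (W a) p).hom y)) :=
      fun a ↦ ((ConcreteCategory.isIso_iff_bijective _).1
        (inferInstance : IsIso (singularCohomology.mapIso R R (θ a) p).hom)).comp
        ((ConcreteCategory.isIso_iff_bijective (homologyIsoSingularCohomology R (W a) p).hom).1 inferInstance)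
    constructor
    · intro y y' h
      funext a
      exact (hcomp a).1 (congrFun h a)
    · intro w
      choose y hy using fun a ↦ (hcomp a).2 (w a)
      exact ⟨y, funext hy⟩
  -- the square: `piRestrict ∘ iso = Φ ∘ (resH_a)_a`
  have hsq : ∀ z : (subsetCochains R 𝑹 (⋃ a, W a)).homology p,
      singularCohomology.piRestrict R R P p ((homologyIsoSingularCohomology R (⋃ a, W a) p).hom z) =
        Φ (fun a ↦ resH (N := 𝑹) (subset_iUnion W a) p z) := fun z ↦ by
    funext a
    rw [singularCohomology.piRestrict_apply]
    change singularCohomology.map R R (subsetIncl (P a)) p _ = singularCohomology.map R R (θ a : C(↥(P a), ↥(W a))) p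
      ((homologyIsoSingularCohomology R (W a) p).hom (resH (N := 𝑹) (subset_iUnion W a) p z))
    have hmap : subsetIncl (P a) = (ContinuousMap.inclusion (subset_iUnion W a)).comp (θ a : C(↥(P a), ↥(W a))) :=
      ContinuousMap.ext fun x ↦ Subtype.ext rfl
    rw [homologyIsoSingularCohomology_hom_resH, hmap, singularCohomology.map_comp, ModuleCat.comp_apply]
  have hbij : Function.Bijective (Φ ∘ fun z : (subsetCochains R 𝑹 (⋃ a, W a)).homology p ↦
      fun a ↦ resH (N := 𝑹) (subset_iUnion W a) p z) := by
    have : (Φ ∘ fun z : (subsetCochains R 𝑹 (⋃ a, W a)).homology p ↦ fun a ↦ resH (N := 𝑹) (subset_iUnion W a) p z) =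
        (singularCohomology.piRestrict R R P p) ∘ (homologyIsoSingularCohomology R (⋃ a, W a) p).hom :=
      funext fun z ↦ (hsq z).symm
    rw [this]
    exact hpi.comp ((ConcreteCategory.isIso_iff_bijective (homologyIsoSingularCohomology R (⋃ a, W a) p).hom).1 inferInstance)
  exact (Function.Bijective.of_comp_iff' hΦ _).1 hbij

end subsetCochains

/-! ### Leray–Hirsch over disjoint unions, finite unions, and hereditarily -/

namespace LHSubset

variable {R : Type v} [CommRing R] {X B : Type u} [TopologicalSpace X] [TopologicalSpace B]
  (q : C(X, B)) {ι : Type} [Fintype ι] (d : ι → ℕ) (β : (k : ι) → SingularSimplex X (d k) → R)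
  (hβ : ∀ k, (singularCochainComplex R R X).d (d k) (d k + 1) (β k) = 0)

/-- Local notation: the coefficient object `ULift R` of `ModuleCat.{max u v} R`. -/
local notation "𝑹" => SimplexSpan.coefR R

/-- **Leray–Hirsch over a pairwise disjoint union of open sets** from Leray–Hirsch over each of
them (additivity of cohomology over disjoint open unions in `B` and in `X`, Hatcher §3.1 p. 202;
the step of Husemoller's / Milnor's reduction treating a disjoint union of trivialising sets as
one). [cite: HatcherAT2002, §3.1 p. 202] -/
theorem isLHOn_iUnion_of_disjoint {α : Type} (U : α → Set B) (hUo : ∀ a, IsOpen (U a)) (hdis : Pairwise (Disjoint on U))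
    (h : ∀ a, IsLHOn q d β hβ (U a) (q ⁻¹' U a) (subsetCochains.mapsTo_preimage_left q (U a))) :
    IsLHOn q d β hβ (⋃ a, U a) (q ⁻¹' ⋃ a, U a) (subsetCochains.mapsTo_preimage_left q (⋃ a, U a)) := by
  have hset : (⋃ a, q ⁻¹' U a) = q ⁻¹' ⋃ a, U a := (preimage_iUnion).symm
  rw [← subsetCochains.isLHOn_set_congr d β hβ q rfl hset (fun x hx ↦ by rw [hset] at hx; exact hx)
    (subsetCochains.mapsTo_preimage_left q (⋃ a, U a))]
  have hW : ∀ a, q ⁻¹' U a ⊆ ⋃ a, q ⁻¹' U a := fun a ↦ subset_iUnion (fun a ↦ q ⁻¹' U a) a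
  have rB := fun (e : ℕ) ↦ subsetCochains.resH_pi_bijective (R := R) U hUo hdis e
  have rX := fun (n : ℕ) ↦ subsetCochains.resH_pi_bijective (R := R) (fun a ↦ q ⁻¹' U a)
    (fun a ↦ (hUo a).preimage q.continuous) (fun a b hab ↦ (hdis hab).preimage q) n
  -- compatibility of `θ` with the restrictions to the pieces
  have hcomp : ∀ (n : ℕ) (c : Src (R := R) d (⋃ a, U a) n) (a : α),
      subsetCochains.resH (N := 𝑹) (hW a) n
        (lhMap q d β hβ (⋃ a, U a) (⋃ a, q ⁻¹' U a) (fun x hx ↦ by rw [hset] at hx; exact hx) n c) =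
        lhMap q d β hβ (U a) (q ⁻¹' U a) (subsetCochains.mapsTo_preimage_left q (U a)) n
          (resSrc d (subset_iUnion U a) n c) := fun n c a ↦
    resH_lhMap q d β hβ (subset_iUnion U a) (hW a) _ _ n c
  intro n
  refine ⟨fun c hc ↦ ?_, fun z ↦ ?_⟩
  · -- injectivity: all restrictions of `c` vanish
    have hres : ∀ a, resSrc d (subset_iUnion U a) n c = 0 := fun a ↦ (h a n).1 _ (by rw [← hcomp, hc, map_zero])
    funext s
    apply (rB s.deg).1
    funext a
    have := congrFun (hres a) s
    rw [resSrc_apply] at this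
    change subsetCochains.resH (N := 𝑹) (subset_iUnion U a) s.deg (c s) =
      subsetCochains.resH (N := 𝑹) (subset_iUnion U a) s.deg ((0 : Src (R := R) d (⋃ a, U a) n) s)
    rw [this, Pi.zero_apply, Pi.zero_apply, map_zero]
  · -- surjectivity: glue the sources of the restrictions
    have hz : ∀ a, ∃ ca : Src (R := R) d (U a) n,
        lhMap q d β hβ (U a) (q ⁻¹' U a) (subsetCochains.mapsTo_preimage_left q (U a)) n ca =
          subsetCochains.resH (N := 𝑹) (hW a) n z := fun a ↦ (h a n).2 _
    choose ca hca using hz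
    -- glue componentwise in the index `s`
    have hglue : ∀ s : Idx d n, ∃ cs : (subsetCochains R 𝑹 (⋃ a, U a)).homology s.deg,
        ∀ a, subsetCochains.resH (N := 𝑹) (subset_iUnion U a) s.deg cs = ca a s := fun s ↦ by
      obtain ⟨cs, hcs⟩ := (rB s.deg).2 (fun a ↦ ca a s)
      exact ⟨cs, fun a ↦ congrFun hcs a⟩
    choose c hc using hglue
    refine ⟨c, (rX n).1 (funext fun a ↦ ?_)⟩
    change subsetCochains.resH (N := 𝑹) (hW a) n (lhMap q d β hβ (⋃ a, U a) (⋃ a, q ⁻¹' U a) _ n c) =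
      subsetCochains.resH (N := 𝑹) (hW a) n z
    rw [hcomp, ← hca a]
    congr 1
    funext s
    rw [resSrc_apply, hc]

/-- **Leray–Hirsch HEREDITARILY over `U`**: the comparison maps are bijective over every open
`U' ⊆ U` (through `q⁻¹U'`) — the form in which "Leray–Hirsch over trivialising sets" propagates
through the Mayer–Vietoris induction (intersections of the sets occurring stay of the same kind).
[cite: HusemollerFibreBundles1994, Ch. 17 §1 Thm. 1.1 (proof)] -/
def LocLH (U : Set B) : Prop :=
  ∀ U' ⊆ U, IsOpen U' → IsLHOn q d β hβ U' (q ⁻¹' U') (subsetCochains.mapsTo_preimage_left q U')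

/-- `LocLH` passes to subsets. [folklore] -/
theorem locLH_mono {U V : Set B} (hUV : V ⊆ U) (h : LocLH q d β hβ U) : LocLH q d β hβ V :=
  fun U' hU' hU'o ↦ h U' (hU'.trans hUV) hU'o

/-- **`LocLH` is closed under binary unions of open sets** (the gluing step `isLHOn_union`
applied to `U' ∩ U`, `U' ∩ V`). [cite: HusemollerFibreBundles1994, Ch. 17 §1 Thm. 1.1 (proof)] -/
theorem locLH_union {U V : Set B} (hUo : IsOpen U) (hVo : IsOpen V) (hU : LocLH q d β hβ U) (hV : LocLH q d β hβ V) :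
    LocLH q d β hβ (U ∪ V) := by
  intro U' hU' hU'o
  have h1 := hU (U' ∩ U) inter_subset_right (hU'o.inter hUo)
  have h2 := hV (U' ∩ V) inter_subset_right (hU'o.inter hVo)
  have h3 : IsLHOn q d β hβ (U' ∩ U ∩ (U' ∩ V)) (q ⁻¹' (U' ∩ U) ∩ q ⁻¹' (U' ∩ V))
      (subsetCochains.mapsTo_preimage_inter q (U' ∩ U) (U' ∩ V)) := by
    have h := hU (U' ∩ U ∩ (U' ∩ V)) (inter_subset_left.trans inter_subset_right)
      ((hU'o.inter hUo).inter (hU'o.inter hVo))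
    exact (subsetCochains.isLHOn_set_congr d β hβ q rfl preimage_inter _ _).1 h
  have h4 := isLHOn_union q d β hβ (hU'o.inter hUo) (hU'o.inter hVo) h1 h2 h3
  have hset : U' ∩ U ∪ U' ∩ V = U' := by
    rw [← inter_union_distrib_left, inter_eq_left]
    exact hU'
  exact (subsetCochains.isLHOn_set_congr d β hβ q hset (by rw [← preimage_union, hset]) _ _).1 h4

/-- **`LocLH` is closed under finite unions of open sets.** [cite: HusemollerFibreBundles1994, Ch. 17 §1 Thm. 1.1 (proof)] -/
theorem locLH_biUnion_finset {κ : Type} (V : κ → Set B) (hVo : ∀ k, IsOpen (V k)) (hV : ∀ k, LocLH q d β hβ (V k))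
    (s : Finset κ) : LocLH q d β hβ (⋃ k ∈ s, V k) := by
  classical
  induction s using Finset.induction_on with
  | empty =>
    intro U' hU' _
    have hU'e : U' = ∅ := subset_eq_empty (by simpa using hU') rfl
    subst hU'e
    intro n
    haveI : Subsingleton ((subsetCochains R 𝑹 (q ⁻¹' (∅ : Set B))).homology n) := by
      rw [preimage_empty]
      exact subsetCochains.subsingleton_homology_empty n
    refine ⟨fun c _ ↦ ?_, fun y ↦ ⟨0, Subsingleton.elim _ _⟩⟩
    funext s
    haveI : Subsingleton ((subsetCochains R 𝑹 (∅ : Set B)).homology s.deg) :=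
      subsetCochains.subsingleton_homology_empty s.deg
    exact Subsingleton.elim _ _
  | insert k s hk ih =>
    rw [Finset.set_biUnion_insert]
    exact locLH_union q d β hβ (hVo k) (isOpen_biUnion fun k _ ↦ hVo k) (hV k) ih

/-- **`LocLH` is closed under pairwise disjoint unions of open sets.** [cite: HatcherAT2002, §3.1 p. 202] -/
theorem locLH_iUnion_of_disjoint {α : Type} (U : α → Set B) (hUo : ∀ a, IsOpen (U a)) (hdis : Pairwise (Disjoint on U))
    (h : ∀ a, LocLH q d β hβ (U a)) : LocLH q d β hβ (⋃ a, U a) := by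
  intro U' hU' hU'o
  have hset : (⋃ a, U' ∩ U a) = U' := by
    rw [← inter_iUnion, inter_eq_left]
    exact hU'
  have h' := isLHOn_iUnion_of_disjoint q d β hβ (fun a ↦ U' ∩ U a) (fun a ↦ hU'o.inter (hUo a))
    (fun a b hab ↦ (hdis hab).mono inter_subset_right inter_subset_right)
    (fun a ↦ h a (U' ∩ U a) inter_subset_right (hU'o.inter (hUo a)))
  exact (subsetCochains.isLHOn_set_congr d β hβ q hset (by rw [hset]) _ _).1 h'

/-! ### From a countable cover to the whole base: the band decomposition -/

section Bands

variable [NormalSpace B] [ParacompactSpace B]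

/-- The height function `h = Σ_k k ψ_k` of a partition of unity indexed by `ℕ`. [cite: MilnorStasheffAMS76, §5 Lemma 5.9 (proof)] -/
def height (ψ : PartitionOfUnity ℕ B) : B → ℝ := fun b ↦ ∑ᶠ k, ψ k b • (k : ℝ)

omit [NormalSpace B] [ParacompactSpace B] in
/-- The height function is continuous. [folklore] -/
theorem continuous_height (ψ : PartitionOfUnity ℕ B) : Continuous (height ψ) :=
  ψ.continuous_finsum_smul fun _ _ _ ↦ continuousAt_const

omit [NormalSpace B] [ParacompactSpace B] in
/-- The height function is non-negative. [folklore] -/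
theorem height_nonneg (ψ : PartitionOfUnity ℕ B) (b : B) : 0 ≤ height ψ b :=
  finsum_nonneg fun k ↦ smul_nonneg (ψ.nonneg k b) (Nat.cast_nonneg k)

omit [NormalSpace B] [ParacompactSpace B] in
/-- **Where the height is `< k + 1`, one of `ψ_0, …, ψ_k` is positive**, so the point lies in one of
the sets `V 0, …, V k` to which `ψ` is subordinate. [cite: MilnorStasheffAMS76, §5 Lemma 5.9 (proof)] -/
theorem exists_mem_of_height_lt (ψ : PartitionOfUnity ℕ B) {V : ℕ → Set B} (hψ : ψ.IsSubordinate V) (b : B) (k : ℕ)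
    (hb : height ψ b < k + 1) : ∃ m, m ≤ k ∧ b ∈ V m := by
  by_contra hcon
  have hzero : ∀ m, m ≤ k → ψ m b = 0 := fun m hm ↦ by
    by_contra hne
    exact hcon ⟨m, hm, hψ m (subset_tsupport _ (mem_support.2 hne))⟩
  have hfin : (Function.support fun m ↦ ψ m b).Finite := ψ.locallyFinite.point_finite b
  have hf1 : Function.HasFiniteSupport (fun m ↦ ψ m b • (m : ℝ)) :=
    hfin.subset fun m hm ↦ by
      rw [mem_support] at hm ⊢
      exact fun h0 ↦ hm (by rw [h0, zero_smul])
  have hf2 : Function.HasFiniteSupport (fun m ↦ ψ m b • ((k : ℝ) + 1)) :=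
    hfin.subset fun m hm ↦ by
      rw [mem_support] at hm ⊢
      exact fun h0 ↦ hm (by rw [h0, zero_smul])
  have hle : (fun m ↦ ψ m b • ((k : ℝ) + 1)) ≤ fun m ↦ ψ m b • (m : ℝ) := fun m ↦ by
    by_cases hm : m ≤ k
    · simp only [hzero m hm, zero_smul, le_refl]
    · exact smul_le_smul_of_nonneg_left (by exact_mod_cast Nat.lt_of_not_le hm) (ψ.nonneg m b)
  have h1 : ∑ᶠ m, ψ m b • ((k : ℝ) + 1) ≤ height ψ b := finsum_le_finsum' hf2 hf1 hle
  have h2 : ∑ᶠ m, ψ m b • ((k : ℝ) + 1) = (k : ℝ) + 1 := by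
    simp_rw [smul_eq_mul]
    rw [← finsum_mul (fun m ↦ ψ m b) ((k : ℝ) + 1), ψ.sum_eq_one (mem_univ b), one_mul]
  linarith

/-- The bands `A_k = h⁻¹(k - 1, k + 1)`. [cite: MilnorStasheffAMS76, §5 Lemma 5.9 (proof)] -/
def band (ψ : PartitionOfUnity ℕ B) (k : ℕ) : Set B := height ψ ⁻¹' Ioo ((k : ℝ) - 1) ((k : ℝ) + 1)

omit [NormalSpace B] [ParacompactSpace B] in
/-- The bands are open. [folklore] -/
theorem isOpen_band (ψ : PartitionOfUnity ℕ B) (k : ℕ) : IsOpen (band ψ k) :=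
  isOpen_Ioo.preimage (continuous_height ψ)

omit [NormalSpace B] [ParacompactSpace B] in
/-- Every point lies in a band (`k = ⌊h b⌋`). [folklore] -/
theorem exists_mem_band (ψ : PartitionOfUnity ℕ B) (b : B) : ∃ k, b ∈ band ψ k := by
  refine ⟨⌊height ψ b⌋₊, ?_, ?_⟩
  · have := Nat.floor_le (height_nonneg ψ b)
    linarith
  · exact Nat.lt_floor_add_one _

omit [NormalSpace B] [ParacompactSpace B] in
/-- Bands of the same parity are pairwise disjoint. [folklore] -/
theorem disjoint_band (ψ : PartitionOfUnity ℕ B) (r : ℕ) :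
    Pairwise (Disjoint on fun j : ℕ ↦ band ψ (2 * j + r)) := by
  intro j j' hjj'
  rw [Function.onFun, Set.disjoint_left]
  rintro b ⟨h1, h2⟩ ⟨h3, h4⟩
  apply hjj'
  have e1 : ((2 * j + r : ℕ) : ℝ) = 2 * j + r := by push_cast; ring
  have e2 : ((2 * j' + r : ℕ) : ℝ) = 2 * j' + r := by push_cast; ring
  rw [e1] at h1 h2
  rw [e2] at h3 h4
  have h5 : (j : ℝ) < j' + 1 := by linarith
  have h6 : (j' : ℝ) < j + 1 := by linarith
  have h7 : j < j' + 1 := by exact_mod_cast h5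
  have h8 : j' < j + 1 := by exact_mod_cast h6
  omega

/-- **From a countable cover to the whole base**: over a paracompact normal base, if Leray–Hirsch
holds hereditarily over every member of a countable open cover `V`, it holds hereditarily over
the whole base (the bands `A_k = h⁻¹(k - 1, k + 1)` of the height `h = Σ k ψ_k` lie in
`V 0 ∪ … ∪ V k`; the base is the union of the disjoint union of the odd bands and of the disjoint
union of the even bands; Milnor–Stasheff §5, proof of Lemma 5.9). [cite: MilnorStasheffAMS76, §5 Lemma 5.9 (proof)] -/
theorem locLH_univ_of_nat_cover (V : ℕ → Set B) (hVo : ∀ k, IsOpen (V k)) (hVcov : ⋃ k, V k = univ)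
    (hV : ∀ k, LocLH q d β hβ (V k)) : LocLH q d β hβ (univ : Set B) := by
  obtain ⟨ψ, hψ⟩ := PartitionOfUnity.exists_isSubordinate isClosed_univ V hVo (by rw [hVcov])
  -- the bands lie in finite unions of the `V m`
  have hband : ∀ k, LocLH q d β hβ (band ψ k) := fun k ↦ by
    refine locLH_mono q d β hβ ?_ (locLH_biUnion_finset q d β hβ V hVo hV (Finset.range (k + 1)))
    intro b hb
    obtain ⟨m, hm, hbm⟩ := exists_mem_of_height_lt ψ hψ b k hb.2
    exact mem_biUnion (Finset.mem_range.2 (by omega)) hbm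
  -- odd and even bands
  have hO := locLH_iUnion_of_disjoint q d β hβ (fun j ↦ band ψ (2 * j + 1)) (fun j ↦ isOpen_band ψ _)
    (disjoint_band ψ 1) fun j ↦ hband _
  have hE := locLH_iUnion_of_disjoint q d β hβ (fun j ↦ band ψ (2 * j + 0)) (fun j ↦ isOpen_band ψ _)
    (disjoint_band ψ 0) fun j ↦ hband _
  have hOE := locLH_union q d β hβ (isOpen_iUnion fun j ↦ isOpen_band ψ _) (isOpen_iUnion fun j ↦ isOpen_band ψ _) hO hE
  have hcov : (⋃ j, band ψ (2 * j + 1)) ∪ (⋃ j, band ψ (2 * j + 0)) = univ := by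
    refine eq_univ_of_forall fun b ↦ ?_
    obtain ⟨k, hk⟩ := exists_mem_band ψ b
    rcases Nat.even_or_odd k with ⟨j, rfl⟩ | ⟨j, rfl⟩
    · exact Or.inr (mem_iUnion.2 ⟨j, by rwa [add_zero, two_mul]⟩)
    · exact Or.inl (mem_iUnion.2 ⟨j, hk⟩)
  rwa [hcov] at hOE

end Bands

end LHSubset

end Literature.AlgebraicTopology.SingularHomology
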